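import Summits.AtomisticToContinuum.Crystallization.Theorems.ExcessDecayLiouvilleHcpLiouvilleBlowdownCapacityZ3
import Summits.AtomisticToContinuum.Crystallization.Theorems.ExcessDecayLiouvillePathSums
import Summits.AtomisticToContinuum.Crystallization.Theorems.ExcessDecayLiouvilleLatticeParam

/-!
# `ExcessDecayLiouville.HcpLiouville` (stmt-AtomisticToContinuum-9332), line `Sketch` v4: the capacity inequality

Sub-goal `blowdown_capacity` (part H1 of `stub_green`) of crux stmt-AtomisticToContinuum-9332: "the 3D lattice is
transient" — for an admissible two-lattice `(t, A)` and a finitely supported field `w` on its sites, point values are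
controlled by the nearest-neighbour strain energy with a universal constant,

`‖w p‖² ≤ 1176 · nnForm t A w`   (`blowdown_capacity`, `1176 = 196 · 6`).

Proof: parametrise the sublattice through `p` by `ℤ³` (`exists_siteParam`), pull `w` back to the octant `ℕ³` at `p`,
apply the pure lattice inequality `blowdown_capacityZ3` (`‖G 0‖² ≤ 196 · sup_n E_n(G)`), and bound the three
coordinate-shift energies by `nnForm` through the translation estimates along `A u₁`, `A u₂` (`≤ nnForm`,
`tsum_norm_sub_translate_sq_le_nnForm`) and `A w₃` (`≤ 4 · nnForm`, `tsum_norm_sub_vertical_sq_le_nnForm`).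
All `[folklore]`; a `--supports` helper for item stmt-AtomisticToContinuum-9332, nothing here closes an item.
-/

noncomputable section

namespace Summit.AtomisticToContinuum.Crystallization.Theorems.ExcessDecayLiouville

open scoped BigOperators Topology Classical InnerProductSpace RealInnerProductSpace
open Literature.MathematicalPhysics.StatisticalMechanics
open Summit.AtomisticToContinuum.Crystallization.Theses.ExcessDecayLiouville
open Summit.AtomisticToContinuum.Crystallization.Theorems.PhononStabilityNegative

section

variable {t : Fin 2 → (EuclideanSpace ℝ (Fin 3))} {A : (EuclideanSpace ℝ (Fin 3)) →L[ℝ] (EuclideanSpace ℝ (Fin 3))}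

/-- A finite sum of squared translation differences over an injectively parametrised family of sites is dominated
by the `tsum` over all sites (finitely supported field, lattice translation). [folklore] -/
theorem sum_norm_sub_translate_sq_le_tsum {w : (EuclideanSpace ℝ (Fin 3)) → (EuclideanSpace ℝ (Fin 3))}
    (hw : (Function.support w).Finite) {τ : (EuclideanSpace ℝ (Fin 3))} (hτ : τ ∈ Λ₀)
    {ι : Type*} (s : Finset ι) {ψ : ι → Sites₀ t A} (hψ : Function.Injective ψ) :
    ∑ x ∈ s, ‖w ((ψ x : (EuclideanSpace ℝ (Fin 3))) + A τ) - w (ψ x)‖ ^ 2 ≤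
      ∑' q : Sites₀ t A, ‖w q - w ((q : (EuclideanSpace ℝ (Fin 3))) + A τ)‖ ^ 2 := by
  classical
  have hS0 := summable_norm_sub_map_sq (t := t) (A := A) hw (sitesTranslate_injective (t := t) (A := A) hτ)
  have hS : Summable (fun q : Sites₀ t A => ‖w q - w ((q : (EuclideanSpace ℝ (Fin 3))) + A τ)‖ ^ 2) := hS0
  have hS' : Summable (fun q : Sites₀ t A => ‖w ((q : (EuclideanSpace ℝ (Fin 3))) + A τ) - w q‖ ^ 2) :=
    hS.congr fun q => by rw [norm_sub_rev]
  calc ∑ x ∈ s, ‖w ((ψ x : (EuclideanSpace ℝ (Fin 3))) + A τ) - w (ψ x)‖ ^ 2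
      = ∑ q ∈ s.image ψ, ‖w ((q : (EuclideanSpace ℝ (Fin 3))) + A τ) - w q‖ ^ 2 :=
        (Finset.sum_image (f := fun q : Sites₀ t A => ‖w ((q : (EuclideanSpace ℝ (Fin 3))) + A τ) - w q‖ ^ 2)
          fun x _ y _ h => hψ h).symm
    _ ≤ ∑' q : Sites₀ t A, ‖w ((q : (EuclideanSpace ℝ (Fin 3))) + A τ) - w q‖ ^ 2 :=
        hS'.sum_le_tsum _ fun _ _ => sq_nonneg _
    _ = ∑' q : Sites₀ t A, ‖w q - w ((q : (EuclideanSpace ℝ (Fin 3))) + A τ)‖ ^ 2 :=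
        tsum_congr fun q => by rw [norm_sub_rev]

end

/-- **H1, the capacity inequality** ("the 3D lattice is transient"): point values of finitely supported fields on the
sites of an admissible two-lattice are bounded by the nearest-neighbour strain energy, with a universal constant.
[folklore] -/
theorem blowdown_capacity : ∃ C : ℝ, ∀ (t : Fin 2 → (EuclideanSpace ℝ (Fin 3)))
    (A : (EuclideanSpace ℝ (Fin 3)) →L[ℝ] (EuclideanSpace ℝ (Fin 3))), Adm₀ A → Inner₀ t A →
    ∀ w : (EuclideanSpace ℝ (Fin 3)) → (EuclideanSpace ℝ (Fin 3)), (Function.support w).Finite →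
    Function.support w ⊆ Sites₀ t A → ∀ p ∈ Sites₀ t A, ‖w p‖ ^ 2 ≤ C * nnForm t A w := by
  refine ⟨196 * 6, fun t A hA hI w hw _ p hp => ?_⟩
  obtain ⟨e, he⟩ := exists_siteParam hA hI
  obtain ⟨⟨m, i₀, j₀, k₀⟩, hx⟩ := e.surjective ⟨p, hp⟩
  -- the parametrisation of the octant at `p` inside the sublattice `m`, and the pulled-back field
  obtain ⟨ψ, hψ⟩ : ∃ ψ : ℕ × ℕ × ℕ → Sites₀ t A, ∀ a b c : ℕ,
      ψ (a, b, c) = e (m, i₀ + a, j₀ + b, k₀ + c) :=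
    ⟨fun x => e (m, i₀ + x.1, j₀ + x.2.1, k₀ + x.2.2), fun _ _ _ => rfl⟩
  obtain ⟨G, hG⟩ : ∃ G : ℕ × ℕ × ℕ → (EuclideanSpace ℝ (Fin 3)), ∀ x, G x = w (ψ x) := ⟨_, fun _ => rfl⟩
  have hψinj : Function.Injective ψ := by
    rintro ⟨a, b, c⟩ ⟨a', b', c'⟩ hxy
    rw [hψ, hψ] at hxy
    have h := e.injective hxy
    simp only [Prod.mk.injEq] at h
    obtain ⟨-, ha, hb, hc⟩ := h
    rw [add_right_inj, Nat.cast_inj] at ha hb hc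
    rw [ha, hb, hc]
  have hG0 : G (0, 0, 0) = w p := by
    rw [hG, hψ]
    simp [hx]
  have hGfin : (Function.support G).Finite := by
    have h1 : Set.Finite {q : Sites₀ t A | w q ≠ 0} := finite_support_sites hw
    have h2 : Function.support G = ψ ⁻¹' {q : Sites₀ t A | w q ≠ 0} := by
      ext x
      simp only [Function.mem_support, Set.mem_preimage, Set.mem_setOf_eq, hG]
    rw [h2]
    exact h1.preimage hψinj.injOn
  -- the three coordinate shifts are the lattice translations by `A u₁`, `A u₂`, `A w₃`
  have hs1 : ∀ a b c : ℕ, G (a + 1, b, c) =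
      w ((ψ (a, b, c) : (EuclideanSpace ℝ (Fin 3))) + A (triangularVec₁ 1)) := by
    intro a b c
    rw [hG, hψ, hψ, ← (siteParam_succ e he m _ _ _).1]
    simp only [Nat.cast_add, Nat.cast_one, add_assoc]
  have hs2 : ∀ a b c : ℕ, G (a, b + 1, c) =
      w ((ψ (a, b, c) : (EuclideanSpace ℝ (Fin 3))) + A (triangularVec₂ 1)) := by
    intro a b c
    rw [hG, hψ, hψ, ← (siteParam_succ e he m _ _ _).2.1]
    simp only [Nat.cast_add, Nat.cast_one, add_assoc]
  have hs3 : ∀ a b c : ℕ, G (a, b, c + 1) =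
      w ((ψ (a, b, c) : (EuclideanSpace ℝ (Fin 3))) + A (layerNormal (2 * Real.sqrt (2 / 3)))) := by
    intro a b c
    rw [hG, hψ, hψ, ← (siteParam_succ e he m _ _ _).2.2]
    simp only [Nat.cast_add, Nat.cast_one, add_assoc]
  have hu := norm_apply_triangularVec_le hA
  -- the cube energies of `G` are bounded by `6 · nnForm`
  have hEn : ∀ n : ℕ, ∑ x ∈ Finset.range n ×ˢ Finset.range n ×ˢ Finset.range n,
      (‖G (x.1 + 1, x.2.1, x.2.2) - G (x.1, x.2.1, x.2.2)‖ ^ 2 +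
        ‖G (x.1, x.2.1 + 1, x.2.2) - G (x.1, x.2.1, x.2.2)‖ ^ 2 +
        ‖G (x.1, x.2.1, x.2.2 + 1) - G (x.1, x.2.1, x.2.2)‖ ^ 2) ≤ 6 * nnForm t A w := by
    intro n
    rw [Finset.sum_add_distrib, Finset.sum_add_distrib]
    have h1 : ∑ x ∈ Finset.range n ×ˢ Finset.range n ×ˢ Finset.range n,
        ‖G (x.1 + 1, x.2.1, x.2.2) - G (x.1, x.2.1, x.2.2)‖ ^ 2 ≤ nnForm t A w :=
      calc ∑ x ∈ Finset.range n ×ˢ Finset.range n ×ˢ Finset.range n,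
            ‖G (x.1 + 1, x.2.1, x.2.2) - G (x.1, x.2.1, x.2.2)‖ ^ 2
          = ∑ x ∈ Finset.range n ×ˢ Finset.range n ×ˢ Finset.range n,
            ‖w ((ψ x : (EuclideanSpace ℝ (Fin 3))) + A (triangularVec₁ 1)) - w (ψ x)‖ ^ 2 :=
            Finset.sum_congr rfl fun x _ => by rw [hs1, hG]
        _ ≤ ∑' q : Sites₀ t A, ‖w q - w ((q : (EuclideanSpace ℝ (Fin 3))) + A (triangularVec₁ 1))‖ ^ 2 :=
            sum_norm_sub_translate_sq_le_tsum hw triangularVec₁_mem_Λ₀ _ hψinj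
        _ ≤ nnForm t A w := tsum_norm_sub_translate_sq_le_nnForm hA hI hw triangularVec₁_mem_Λ₀ hu.1
    have h2 : ∑ x ∈ Finset.range n ×ˢ Finset.range n ×ˢ Finset.range n,
        ‖G (x.1, x.2.1 + 1, x.2.2) - G (x.1, x.2.1, x.2.2)‖ ^ 2 ≤ nnForm t A w :=
      calc ∑ x ∈ Finset.range n ×ˢ Finset.range n ×ˢ Finset.range n,
            ‖G (x.1, x.2.1 + 1, x.2.2) - G (x.1, x.2.1, x.2.2)‖ ^ 2
          = ∑ x ∈ Finset.range n ×ˢ Finset.range n ×ˢ Finset.range n,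
            ‖w ((ψ x : (EuclideanSpace ℝ (Fin 3))) + A (triangularVec₂ 1)) - w (ψ x)‖ ^ 2 :=
            Finset.sum_congr rfl fun x _ => by rw [hs2, hG]
        _ ≤ ∑' q : Sites₀ t A, ‖w q - w ((q : (EuclideanSpace ℝ (Fin 3))) + A (triangularVec₂ 1))‖ ^ 2 :=
            sum_norm_sub_translate_sq_le_tsum hw triangularVec₂_mem_Λ₀ _ hψinj
        _ ≤ nnForm t A w := tsum_norm_sub_translate_sq_le_nnForm hA hI hw triangularVec₂_mem_Λ₀ hu.2
    have h3 : ∑ x ∈ Finset.range n ×ˢ Finset.range n ×ˢ Finset.range n,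
        ‖G (x.1, x.2.1, x.2.2 + 1) - G (x.1, x.2.1, x.2.2)‖ ^ 2 ≤ 4 * nnForm t A w :=
      calc ∑ x ∈ Finset.range n ×ˢ Finset.range n ×ˢ Finset.range n,
            ‖G (x.1, x.2.1, x.2.2 + 1) - G (x.1, x.2.1, x.2.2)‖ ^ 2
          = ∑ x ∈ Finset.range n ×ˢ Finset.range n ×ˢ Finset.range n,
            ‖w ((ψ x : (EuclideanSpace ℝ (Fin 3))) + A (layerNormal (2 * Real.sqrt (2 / 3)))) - w (ψ x)‖ ^ 2 :=
            Finset.sum_congr rfl fun x _ => by rw [hs3, hG]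
        _ ≤ ∑' q : Sites₀ t A, ‖w q - w ((q : (EuclideanSpace ℝ (Fin 3))) + A (layerNormal (2 * Real.sqrt (2 / 3))))‖ ^ 2 :=
            sum_norm_sub_translate_sq_le_tsum hw layerNormal_two_mem_Λ₀ _ hψinj
        _ ≤ 4 * nnForm t A w := tsum_norm_sub_vertical_sq_le_nnForm hA hI hw
    linarith
  have hcap := blowdown_capacityZ3 G (6 * nnForm t A w) hGfin hEn
  rw [hG0] at hcap
  linarith

end Summit.AtomisticToContinuum.Crystallization.Theorems.ExcessDecayLiouville

end
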